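import Literature.Analysis.FluidPDE.Tao2016AveragedNS.SeedScaleEntry
import HarnessLib

/-!
# After the trigger level: (c-large) for approximate trajectories at the seed scale

Cell `pub-fluidc`, blueprint seat 1 (gen 13) — first part of the firing analysis for approximate
trajectories (successor option (F2)). HONEST FRAMING: low prior, high value-of-information
experiment on Tao's machine paradigm [Tao2016AveragedNS, §5.5]; NOT a claim that NS blows up.

SeedScaleEntry.lean delivers, for every differentiable approximate trajectory `Y` of a member
`delayCircuitWith K M ε` (velocity `V`, sup-defect `‖V - F(Y)‖ ≤ δ` and sup-norm `≤ 2` on `[0,T)`,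
`T ≥ 2`, datum `δ₀`-close to (5.6), seed-scale budget `δ₀ + 2δ ≤ ε²e^{-M}/(8√M)`), the first
hitting time `τ ∈ (1, 8/5]` of the trigger level `ε²/K¹⁰` with `b(τ) ≥ (49/50)ε`. This file runs
Tao's post-critical estimates [Tao2016AveragedNS, §5.5: "b ≳ ε on [t_c, 2]", (c-large)] for such
trajectories on every late window `[τ, T']`, `T' ≤ 2`, `T' < T`:

* `Ignition.abs_c_le_after`: `|c(t)| ≤ 2(ε²/K¹⁰)·e^{(201/100)M(t-τ)}` — the a-priori size of the
  trigger, from the clock's upper bound `b ≤ (201/100)ε` alone (no sign information needed);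
* `Ignition.b_ge_after`: `b ≥ (9/10)ε` — the clock keeps running (`ε⁻¹Mc² ≤ ε/16`);
* `Ignition.c_ge_after`: `c(t) ≥ ½(ε²/K¹⁰)·e^{(9/10)M(t-τ)}` — exponential growth of the trigger;
* `Ignition.c_large_after`: `c ≥ K¹⁰⁰ε²` from `τ + d` on whenever `e^{(9/10)Md} ≥ 2K¹¹⁰`
  (`d = 130 log K/M ≤ 1/20` works: `transition_params`);
* `rotorGate_activated`: the assembled statement with explicit hypotheses and the budget in the
  form `δ₀ + δT ≤ ε²e^{-M}/(8√M)`: the rotor gate of every such approximate trajectory is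
  continuously and strongly activated from `τ + 130 log K/M` on.

The defect enters each estimate additively (`±δ` in the forcing slot of the relevant coordinate,
CascadeDefect.lean), and `δ ≤ ε²e^{-M}/16` is below every scale of the transition phase. What is NOT
here: equipartition `V = adε²/c`, (atc), (toke) and the firing of the output `ã` — the remaining
three phases of [Tao2016AveragedNS, §5.5] for approximate trajectories.

Layout note: the lemmas of `section Seed` whose proofs use the budget only through
`budget_facts'` (`δ₀ + 2δ ≤ ε²e^{-M}/8`) are proved under that WEAK budget in `section Eighth` (primed
names) and re-exported with unchanged statements under the seed-scale budget `ε²e^{-M}/(8√M)`, so that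
the sharp-budget chain (SeedScaleSharp*.lean) can reuse them.
-/

namespace Literature.Analysis.FluidPDE.Tao2016AveragedNS

open Real Set MeasureTheory
open scoped NNReal
open NegKick (clockInt clockInt_zero)

namespace Ignition

/-! ## §0. Numerical facts of the transition phase -/

/-- Under the standing hypotheses: `Mε²e^{5M} ≤ 1/64` (so `ε⁻¹M(2ℓe^{5M/2})² ≤ ε/16` for
`ℓ ≤ ε²`), the onset delay `d = 130 log K/M` satisfies `e^{(9/10)Md} = K¹¹⁷ ≥ 2K¹¹⁰` and
`0 ≤ d ≤ 1/20`. [cite: Tao2016AveragedNS, §5.5 (c-large)] -/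
theorem transition_params {K M ε : ℝ} (hK : 2 * 20 ^ 42 * (Nat.factorial 42 : ℝ) + 16 ≤ K)
    (hML : 3000 * Real.log K ≤ M) (hMK : M ≤ K ^ 10) (hε : 0 < ε)
    (hεle : ε ≤ exp (-(10 * M)) / K ^ 100) :
    M * ε ^ 2 * exp (5 * M) ≤ 1 / 64 ∧
      2 * K ^ 110 ≤ exp (9 / 10 * M * (130 * Real.log K / M)) ∧
      0 ≤ 130 * Real.log K / M ∧ 130 * Real.log K / M ≤ 1 / 20 := by
  obtain ⟨hK16, hM4, -, -, -, -⟩ := negKick_params hK hML hMK hε hεle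
  have hK0 : 0 < K := by linarith
  have hM0 : 0 < M := by linarith
  obtain ⟨-, -, hlog0⟩ := Thm53With.log_facts hK16
  refine ⟨?_, ?_, div_nonneg (mul_nonneg (by norm_num) hlog0.le) hM0.le,
    by rw [div_le_iff₀ hM0]; linarith⟩
  · have h2 : ε ^ 2 ≤ (exp (-(10 * M)) / K ^ 100) ^ 2 := pow_le_pow_left₀ hε.le hεle 2
    have h3 : (exp (-(10 * M)) / K ^ 100) ^ 2 = exp (-(20 * M)) / K ^ 200 := by
      rw [div_pow, sq, ← exp_add, ← pow_mul]; ring_nf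
    rw [h3] at h2
    have h4 : M * ε ^ 2 * exp (5 * M) ≤ K ^ 10 * (exp (-(20 * M)) / K ^ 200) * exp (5 * M) :=
      mul_le_mul_of_nonneg_right (mul_le_mul hMK h2 (sq_nonneg ε) (by positivity)) (exp_pos _).le
    have h5 : K ^ 10 * (exp (-(20 * M)) / K ^ 200) * exp (5 * M) =
        K ^ 10 / K ^ 200 * (exp (-(20 * M)) * exp (5 * M)) := by ring
    have h6 : exp (-(20 * M)) * exp (5 * M) ≤ 1 := by
      rw [← exp_add]; exact exp_le_one_iff.2 (by linarith)
    have h7 : K ^ 10 / K ^ 200 = 1 / K ^ 190 := by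
      rw [div_eq_div_iff (by positivity) (by positivity)]; ring
    have h8 : 1 / K ^ 190 ≤ 1 / 64 := by
      refine one_div_le_one_div_of_le (by norm_num) ?_
      have : (16 : ℝ) ^ 190 ≤ K ^ 190 := pow_le_pow_left₀ (by norm_num) hK16 190
      exact le_trans (by norm_num) this
    have h9 : K ^ 10 / K ^ 200 * (exp (-(20 * M)) * exp (5 * M)) ≤ 1 / 64 * 1 := by
      rw [h7]; exact mul_le_mul h8 h6 (by positivity) (by norm_num)
    linarith
  · have e1 : 9 / 10 * M * (130 * Real.log K / M) = 117 * Real.log K * (M / M) := by ring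
    rw [e1, div_self hM0.ne', mul_one,
      show (117 : ℝ) * Real.log K = ((117 : ℕ) : ℝ) * Real.log K by norm_num,
      Real.exp_nat_mul, Real.exp_log hK0]
    have h7 : (16 : ℝ) ^ 7 ≤ K ^ 7 := pow_le_pow_left₀ (by norm_num) hK16 7
    calc 2 * K ^ 110 ≤ K ^ 7 * K ^ 110 :=
        mul_le_mul_of_nonneg_right (le_trans (by norm_num) h7) (by positivity)
      _ = K ^ 117 := by ring

section Approx

variable {K M ε δ δ₀ T : ℝ} {Y V : ℝ → Fin 5 → ℝ}
  (hY : ∀ t, HasDerivAt Y (V t) t)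
  (hV : ∀ t ∈ Ico 0 T, ‖V t - delayCircuitWith K M ε (Y t)‖ ≤ δ)
  (hR : ∀ t ∈ Ico 0 T, ‖Y t‖ ≤ 2) (hT : 2 ≤ T)
include hY hV hR hT

section Late

variable {T' : ℝ} (hT'T : T' < T) (hT'2 : T' ≤ 2)
include hT'T hT'2

/-! ## §1. The late window `[0, T']`, `T' < T`, `T' ≤ 2` -/

omit hY hV hR hT hT'2 in
/-- Late-window times lie in `[0,T)`. [folklore] -/
theorem mem_Ico_of_mem_late {t : ℝ} (ht : t ∈ Icc (0 : ℝ) T') : t ∈ Ico 0 T :=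
  ⟨ht.1, lt_of_le_of_lt ht.2 hT'T⟩

/-- Energy on the late window: `|energy(Y t) - 1| ≤ 7δ₀ + 40δ`.
[cite: Tao2016AveragedNS, §5.5 (energy-con)] -/
theorem abs_energy_sub_one_late (h0 : ‖Y 0 - delayInit‖ ≤ δ₀) (hδ₀ : δ₀ ≤ 1) {t : ℝ}
    (ht : t ∈ Icc (0 : ℝ) T') : |energy (Y t) - 1| ≤ 7 * δ₀ + 40 * δ := by
  have h1 := abs_energy_sub_le hY hV hR (mem_Ico_of_mem_late hT'T ht)
  have h2 := abs_energy_init_le h0 hδ₀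
  have hδ := defect_nonneg hV hT
  have h3 : |energy (Y t) - 1| ≤ |energy (Y t) - energy (Y 0)| + |energy (Y 0) - 1| := by
    have := abs_add_le (energy (Y t) - energy (Y 0)) (energy (Y 0) - 1)
    rwa [show energy (Y t) - energy (Y 0) + (energy (Y 0) - 1) = energy (Y t) - 1 by ring] at this
  have h4 : 20 * δ * t ≤ 20 * δ * 2 := mul_le_mul_of_nonneg_left (ht.2.trans hT'2) (by positivity)
  linarith

/-- Squares of the modes on the late window: `Yᵢ² ≤ 1 + 7δ₀ + 40δ`.
[cite: Tao2016AveragedNS, §5.5 (energy-con)] -/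
theorem sq_coord_late (h0 : ‖Y 0 - delayInit‖ ≤ δ₀) (hδ₀ : δ₀ ≤ 1) {t : ℝ}
    (ht : t ∈ Icc (0 : ℝ) T') (i : Fin 5) : Y t i ^ 2 ≤ 1 + 7 * δ₀ + 40 * δ := by
  have h1 := (abs_le.1 (abs_energy_sub_one_late hY hV hR hT hT'T hT'2 h0 hδ₀ ht)).2
  have h2 := sq_le_energy (Y t) i
  linarith

/-- Clock upper bound on the late window: `b(t) ≤ δ₀ + (ε(1 + 7δ₀ + 40δ) + δ)t`.
[cite: Tao2016AveragedNS, §5.5 (5.5)] -/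
theorem b_le_late (h0 : ‖Y 0 - delayInit‖ ≤ δ₀) (hδ₀ : δ₀ ≤ 1) (hε : 0 < ε) (hM : 0 ≤ M) {t : ℝ}
    (ht : t ∈ Icc (0 : ℝ) T') :
    Y t 1 ≤ δ₀ + (ε * (1 + 7 * δ₀ + 40 * δ) + δ) * t := by
  obtain ⟨k, hk⟩ : ∃ k : ℝ, k = ε * (1 + 7 * δ₀ + 40 * δ) + δ := ⟨_, rfl⟩
  have hanti := Thm53.antitoneOn_sub_of_deriv_le (s := Icc (0 : ℝ) T') (f := fun s => Y s 1)
    (φ := fun _ => k) (Φ := fun u => k * u) (convex_Icc 0 _)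
    (fun u _ => hasDerivAt_coord (hY u) 1)
    (fun u _ => by simpa using (hasDerivAt_id u).const_mul k) (fun u hu => by
      have hθ := abs_coord_defect_le (hV u (mem_Ico_of_mem_late hT'T hu)) 1
      rw [field_one] at hθ
      have ha := sq_coord_late hY hV hR hT hT'T hT'2 h0 hδ₀ hu 0
      have h1 : ε * Y u 0 ^ 2 ≤ ε * (1 + 7 * δ₀ + 40 * δ) := mul_le_mul_of_nonneg_left ha hε.le
      have h2 : 0 ≤ ε⁻¹ * M * Y u 2 ^ 2 := by positivity
      show V u 1 ≤ k
      rw [hk]; linarith [(abs_le.1 hθ).2])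
  have h := hanti (left_mem_Icc.2 (ht.1.trans ht.2)) ht ht.1
  have hb0 := (abs_le.1 (abs_init_coord_le h0).1).2
  simp only [mul_zero, sub_zero] at h
  rw [← hk]; linarith

/-- Upper bound of the discounted drive on the late window:
`(c·e^{-G})' ≤ (ε²e^{-M}(1 + 7δ₀ + 40δ) + δ)·e^{-G}`. [cite: Tao2016AveragedNS, §5.5] -/
theorem disc_deriv_le_late (h0 : ‖Y 0 - delayInit‖ ≤ δ₀) (hδ₀ : δ₀ ≤ 1) {t : ℝ}
    (ht : t ∈ Icc (0 : ℝ) T') :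
    (V t 2 - ε⁻¹ * M * Y t 1 * Y t 2) * exp (-clockInt ε M Y t) ≤
      (ε ^ 2 * exp (-M) * (1 + 7 * δ₀ + 40 * δ) + δ) * exp (-clockInt ε M Y t) := by
  refine mul_le_mul_of_nonneg_right ?_ (exp_pos _).le
  rw [disc_drive_eq (K := K)]
  have hθ := (abs_le.1 (abs_coord_defect_le (hV t (mem_Ico_of_mem_late hT'T ht)) 2)).2
  have ha := sq_coord_late hY hV hR hT hT'T hT'2 h0 hδ₀ ht 0
  have h1 : ε ^ 2 * exp (-M) * Y t 0 ^ 2 ≤ ε ^ 2 * exp (-M) * (1 + 7 * δ₀ + 40 * δ) :=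
    mul_le_mul_of_nonneg_left ha (by positivity)
  linarith

omit hY hR hT hT'2 in
/-- Lower bound of the discounted drive on the late window: `(c·e^{-G})' ≥ (ε²e^{-M}a² - δ)·e^{-G}`.
[cite: Tao2016AveragedNS, §5.5] -/
theorem disc_deriv_ge_late {t : ℝ} (ht : t ∈ Icc (0 : ℝ) T') :
    (ε ^ 2 * exp (-M) * Y t 0 ^ 2 - δ) * exp (-clockInt ε M Y t) ≤
      (V t 2 - ε⁻¹ * M * Y t 1 * Y t 2) * exp (-clockInt ε M Y t) := by
  refine mul_le_mul_of_nonneg_right ?_ (exp_pos _).le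
  rw [disc_drive_eq (K := K)]
  have hθ := (abs_le.1 (abs_coord_defect_le (hV t (mem_Ico_of_mem_late hT'T ht)) 2)).1
  linarith

section Eighth

/-! ### The same, under the WEAK budget `δ₀ + 2δ ≤ ε²e^{-M}/8` (primed names; the unprimed
names below re-export them under the seed-scale budget with unchanged statements) -/

variable (hK : 2 * 20 ^ 42 * (Nat.factorial 42 : ℝ) + 16 ≤ K) (hML : 3000 * Real.log K ≤ M)
  (hMK : M ≤ K ^ 10) (hε : 0 < ε) (hεle : ε ≤ exp (-(10 * M)) / K ^ 100)
  (h0 : ‖Y 0 - delayInit‖ ≤ δ₀) (hη : δ₀ + 2 * δ ≤ ε ^ 2 * exp (-M) / 8)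
include hK hML hMK hε hεle h0 hη

omit hY hR hT'T hT'2 in
/-- Budget arithmetic of the transition phase: `ε²e^{-M} ≤ ε/10⁶`, `3ε²e^{-M} ≤ ε²/K¹⁰`,
`δ ≤ ε²e^{-M}/16`, `7δ₀ + 40δ ≤ (5/2)ε²e^{-M}`. [cite: Tao2016AveragedNS, §5.5] -/
theorem late_facts' :
    ε ^ 2 * exp (-M) ≤ ε / 1000000 ∧ 3 * (ε ^ 2 * exp (-M)) ≤ ε ^ 2 / K ^ 10 ∧
      δ ≤ ε ^ 2 * exp (-M) / 16 ∧ 7 * δ₀ + 40 * δ ≤ 5 / 2 * (ε ^ 2 * exp (-M)) := by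
  obtain ⟨hM6000, hε1, hε2, hexpM, -, -, -, h77, -⟩ := ignition_params hK hML hMK hε hεle
  obtain ⟨hδ₀, hδ, hη8, -, -, -⟩ := budget_facts' hV hT hK hML hMK hε hεle h0 hη
  obtain ⟨-, -, -, hsK, -⟩ := level_facts hK hML hMK hε hεle
  obtain ⟨hK16, -, -, -, -, -⟩ := negKick_params hK hML hMK hε hεle
  have hK0 : 0 < K := by linarith
  refine ⟨?_, ?_, by linarith, by linarith⟩
  · have h1 : ε * exp (-M) ≤ 1 * (1 / 1000000) := mul_le_mul hε1 hexpM (exp_pos _).le zero_le_one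
    have h2 : ε ^ 2 * exp (-M) = ε * (ε * exp (-M)) := by ring
    rw [h2]
    have h3 : ε * (ε * exp (-M)) ≤ ε * (1 * (1 / 1000000)) := mul_le_mul_of_nonneg_left h1 hε.le
    linarith
  · rw [le_div_iff₀ (by positivity)]
    have h1 : exp (-M) * (3 * K ^ 10) ≤ 1 := (le_div_iff₀ (by positivity)).1 hsK
    have h2 : 3 * (ε ^ 2 * exp (-M)) * K ^ 10 = ε ^ 2 * (exp (-M) * (3 * K ^ 10)) := by ring
    rw [h2]
    have h3 := mul_le_mul_of_nonneg_left h1 (sq_nonneg ε)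
    linarith

/-- **The clock on the late window**: `b ≤ (201/100)ε` on `[0, T']`. [cite: Tao2016AveragedNS, §5.5 (5.5)] -/
theorem b_le_two_late' {t : ℝ} (ht : t ∈ Icc (0 : ℝ) T') : Y t 1 ≤ 201 / 100 * ε := by
  obtain ⟨hM6000, hε1, -, -, -, -, -, -, -⟩ := ignition_params hK hML hMK hε hεle
  obtain ⟨hδ₀, hδ, hη8, hδ₀1, -, -⟩ := budget_facts' hV hT hK hML hMK hε hεle h0 hη
  obtain ⟨hsε, -, -, hA⟩ := late_facts' hV hT hK hML hMK hε hεle h0 hη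
  have hb := b_le_late hY hV hR hT hT'T hT'2 h0 hδ₀1 hε (by linarith) ht
  have hA0 : 0 ≤ 7 * δ₀ + 40 * δ := by positivity
  have h1 : (ε * (1 + 7 * δ₀ + 40 * δ) + δ) * t ≤ (ε * (1 + 7 * δ₀ + 40 * δ) + δ) * 2 :=
    mul_le_mul_of_nonneg_left (ht.2.trans hT'2) (by positivity)
  have h2 : ε * (7 * δ₀ + 40 * δ) ≤ 1 * (7 * δ₀ + 40 * δ) := mul_le_mul_of_nonneg_right hε1 hA0
  linarith

/-- **Clock increments on the late window**: `G(t) - G(u) ≤ (201/100)M(t - u)` for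
`0 ≤ u ≤ t ≤ T'` (`G' = ε⁻¹Mb ≤ (201/100)M`). [cite: Tao2016AveragedNS, §5.5] -/
theorem clockInt_sub_le_late' {u t : ℝ} (hu : 0 ≤ u) (hut : u ≤ t) (ht : t ≤ T') :
    clockInt ε M Y t - clockInt ε M Y u ≤ 201 / 100 * M * (t - u) := by
  obtain ⟨hM6000, -, -, -, -, -, -, -, -⟩ := ignition_params hK hML hMK hε hεle
  have hM0 : 0 ≤ M := by linarith
  obtain ⟨m, hm⟩ : ∃ m : ℝ, m = 201 / 100 * M := ⟨_, rfl⟩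
  have hanti := Thm53.antitoneOn_sub_of_deriv_le (s := Icc (0 : ℝ) T') (f := clockInt ε M Y)
    (φ := fun _ => m) (Φ := fun v => m * v) (convex_Icc 0 T')
    (fun v _ => hasDerivAt_clockIntA hY v)
    (fun v _ => by simpa using (hasDerivAt_id v).const_mul m)
    (fun v hv => by
      have hb := b_le_two_late' hY hV hR hT hT'T hT'2 hK hML hMK hε hεle h0 hη hv
      have h1 : ε⁻¹ * M * Y v 1 ≤ ε⁻¹ * M * (201 / 100 * ε) :=
        mul_le_mul_of_nonneg_left hb (by positivity)
      have e : ε⁻¹ * M * (201 / 100 * ε) = m := by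
        rw [show ε⁻¹ * M * (201 / 100 * ε) = 201 / 100 * M * (ε⁻¹ * ε) by ring,
          inv_mul_cancel₀ hε.ne', mul_one, hm]
      show ε⁻¹ * M * Y v 1 ≤ m
      linarith)
  have h := hanti ⟨hu, hut.trans ht⟩ ⟨hu.trans hut, ht⟩ hut
  simp only at h
  rw [hm] at h
  linarith

section Entry

variable {τ : ℝ} (hτ1 : 1 < τ) (hcτ : Y τ 2 = ε ^ 2 / K ^ 10) (hbτ : 49 / 50 * ε ≤ Y τ 1)
include hτ1 hcτ hbτ

/-! ## §2. The a-priori size of the trigger after `τ` -/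

omit hbτ in
/-- **A-priori bound after the trigger level.** On `[τ, T']`:
`|c(t)| ≤ 2(ε²/K¹⁰)·e^{(201/100)M(t-τ)}`. Both signs come from the discounted trigger
`D = c·e^{-G}`: `|D'| ≤ (ε²e^{-M}·(1+7δ₀+40δ) + δ)·e^{-G(u)}` and
`e^{-G(u)} ≤ e^{-G(t)}·e^{(201/100)M(t-u)}` (clock increments), integrated in closed form.
[cite: Tao2016AveragedNS, §5.5 (code)] -/
theorem abs_c_le_after' {t : ℝ} (ht : t ∈ Icc τ T') :
    |Y t 2| ≤ 2 * (ε ^ 2 / K ^ 10) * exp (201 / 100 * M * (t - τ)) := by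
  obtain ⟨hM6000, hε1, -, -, -, -, -, -, -⟩ := ignition_params hK hML hMK hε hεle
  obtain ⟨hδ₀, hδ, hη8, hδ₀1, -, hs1⟩ := budget_facts' hV hT hK hML hMK hε hεle h0 hη
  obtain ⟨hℓ0, hℓε, -, -, -⟩ := level_facts hK hML hMK hε hεle
  obtain ⟨hsε, h3s, hδs, hA⟩ := late_facts' hV hT hK hML hMK hε hεle h0 hη
  have hM0 : 0 < M := by linarith
  have hτ0 : (0 : ℝ) ≤ τ := by linarith
  have hτt : τ ≤ t := ht.1
  obtain ⟨ℓ, hℓ⟩ : ∃ ℓ : ℝ, ℓ = ε ^ 2 / K ^ 10 := ⟨_, rfl⟩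
  rw [← hℓ] at hℓ0 hℓε h3s hcτ ⊢
  obtain ⟨m, hm⟩ : ∃ m : ℝ, m = 201 / 100 * M := ⟨_, rfl⟩
  have hm0 : 0 < m := by rw [hm]; positivity
  have hm1 : 1 ≤ m := by rw [hm]; linarith
  obtain ⟨k, hk⟩ : ∃ k : ℝ, k = ε ^ 2 * exp (-M) * (1 + 7 * δ₀ + 40 * δ) + δ := ⟨_, rfl⟩
  have hk0 : 0 ≤ k := by rw [hk]; positivity
  have hk2 : k ≤ 2 * (ε ^ 2 * exp (-M)) := by
    have h2 : ε ^ 2 * exp (-M) * (1 + 7 * δ₀ + 40 * δ) ≤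
        ε ^ 2 * exp (-M) * (1 + 5 / 2 * (1 / 1000000)) :=
      mul_le_mul_of_nonneg_left (by linarith) (by positivity)
    rw [hk]; linarith
  have hkℓ : k / m ≤ ℓ := by
    have h1 : k / m ≤ k := div_le_self hk0 hm1
    linarith
  have hδm : δ / m ≤ ℓ := by
    have h1 : δ / m ≤ δ := div_le_self hδ hm1
    linarith
  obtain ⟨E, hE⟩ : ∃ E : ℝ, E = exp (m * (t - τ)) := ⟨_, rfl⟩
  have hE0 : 0 < E := by rw [hE]; exact exp_pos _
  have hEgoal : exp (201 / 100 * M * (t - τ)) = E := by rw [hE, hm]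
  -- clock increments
  have hGinc : ∀ u, 0 ≤ u → u ≤ t → clockInt ε M Y t - clockInt ε M Y u ≤ m * (t - u) := by
    intro u hu hut
    rw [hm]
    exact clockInt_sub_le_late' hY hV hR hT hT'T hT'2 hK hML hMK hε hεle h0 hη hu hut ht.2
  have hexpG : ∀ u ∈ Icc τ t,
      exp (-clockInt ε M Y u) ≤ exp (-clockInt ε M Y t) * exp (m * (t - u)) := by
    intro u hu
    rw [← exp_add]
    exact exp_le_exp.2 (by linarith [hGinc u (hτ0.trans hu.1) hu.2])
  -- the comparison functions `x ↦ ∓(r/m)·e^{m(t-x)}`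
  have hcmp : ∀ r : ℝ, ∀ u : ℝ,
      HasDerivAt (fun x => -(r / m) * exp (m * (t - x))) (r * exp (m * (t - u))) u := by
    intro r u
    have h1 : HasDerivAt (fun x => m * (t - x)) (m * -1) u :=
      ((hasDerivAt_id' u).const_sub t).const_mul m
    refine ((h1.exp).const_mul (-(r / m))).congr_deriv ?_
    calc -(r / m) * (exp (m * (t - u)) * (m * -1)) = r * exp (m * (t - u)) * (m / m) := by ring
      _ = r * exp (m * (t - u)) := by rw [div_self hm0.ne', mul_one]
  -- upper comparison
  obtain ⟨q, hq⟩ : ∃ q : ℝ, q = k * exp (-clockInt ε M Y t) := ⟨_, rfl⟩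
  have hq0 : 0 ≤ q := by rw [hq]; positivity
  have hanti := Thm53.antitoneOn_sub_of_deriv_le (s := Icc τ t)
    (f := fun s => Y s 2 * exp (-clockInt ε M Y s))
    (φ := fun u => q * exp (m * (t - u))) (Φ := fun x => -(q / m) * exp (m * (t - x)))
    (convex_Icc τ t) (fun u _ => hasDerivAt_discA hY u) (fun u _ => hcmp q u)
    (fun u hu => by
      have hu' : u ∈ Icc (0 : ℝ) T' := ⟨hτ0.trans hu.1, hu.2.trans ht.2⟩
      have h1 := disc_deriv_le_late hY hV hR hT hT'T hT'2 h0 hδ₀1 hu'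
      rw [← hk] at h1
      have h2 : k * exp (-clockInt ε M Y u) ≤
          k * (exp (-clockInt ε M Y t) * exp (m * (t - u))) :=
        mul_le_mul_of_nonneg_left (hexpG u hu) hk0
      have h3 : k * (exp (-clockInt ε M Y t) * exp (m * (t - u))) = q * exp (m * (t - u)) := by
        rw [hq]; ring
      show (V u 2 - ε⁻¹ * M * Y u 1 * Y u 2) * exp (-clockInt ε M Y u) ≤ q * exp (m * (t - u))
      linarith)
  have hup := hanti (left_mem_Icc.2 hτt) (right_mem_Icc.2 hτt) hτt
  simp only [sub_self, mul_zero, exp_zero, mul_one] at hup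
  rw [← hE, hcτ] at hup
  have hqm : 0 ≤ q / m := div_nonneg hq0 hm0.le
  have key : Y t 2 * exp (-clockInt ε M Y t) ≤ ℓ * exp (-clockInt ε M Y τ) + q / m * E := by
    linarith [hup, hqm]
  -- lower comparison
  obtain ⟨p, hp⟩ : ∃ p : ℝ, p = δ * exp (-clockInt ε M Y t) := ⟨_, rfl⟩
  have hp0 : 0 ≤ p := by rw [hp]; positivity
  have hmono := Thm53.monotoneOn_sub_of_le_deriv (s := Icc τ t)
    (f := fun s => Y s 2 * exp (-clockInt ε M Y s))
    (φ := fun u => -p * exp (m * (t - u))) (Φ := fun x => -(-p / m) * exp (m * (t - x)))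
    (convex_Icc τ t) (fun u _ => hasDerivAt_discA hY u) (fun u _ => hcmp (-p) u)
    (fun u hu => by
      have hu' : u ∈ Icc (0 : ℝ) T' := ⟨hτ0.trans hu.1, hu.2.trans ht.2⟩
      have h1 := disc_deriv_ge_late hV hT'T hu' (K := K)
      have h2 : 0 ≤ ε ^ 2 * exp (-M) * Y u 0 ^ 2 * exp (-clockInt ε M Y u) := by positivity
      have h3 : δ * exp (-clockInt ε M Y u) ≤
          δ * (exp (-clockInt ε M Y t) * exp (m * (t - u))) :=
        mul_le_mul_of_nonneg_left (hexpG u hu) hδ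
      have h4 : δ * (exp (-clockInt ε M Y t) * exp (m * (t - u))) = p * exp (m * (t - u)) := by
        rw [hp]; ring
      show -p * exp (m * (t - u)) ≤ (V u 2 - ε⁻¹ * M * Y u 1 * Y u 2) * exp (-clockInt ε M Y u)
      linarith [h1, h2, h3, h4])
  have hlo := hmono (left_mem_Icc.2 hτt) (right_mem_Icc.2 hτt) hτt
  simp only [sub_self, mul_zero, exp_zero, mul_one] at hlo
  rw [← hE, hcτ] at hlo
  have hpm : 0 ≤ p / m := div_nonneg hp0 hm0.le
  have key2 : ℓ * exp (-clockInt ε M Y τ) - p / m * E ≤ Y t 2 * exp (-clockInt ε M Y t) := by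
    have e : -(-p / m) = p / m := by ring
    rw [e] at hlo
    linarith [hlo, hpm]
  -- undo the discount
  have hP : 0 < exp (clockInt ε M Y t) := exp_pos _
  have hinv : exp (-clockInt ε M Y t) * exp (clockInt ε M Y t) = 1 := by
    rw [← exp_add, neg_add_cancel, exp_zero]
  have hshift : exp (-clockInt ε M Y τ) * exp (clockInt ε M Y t) ≤ E := by
    rw [← exp_add, hE]
    exact exp_le_exp.2 (by linarith [hGinc τ hτ0 hτt])
  have e1 : Y t 2 * exp (-clockInt ε M Y t) * exp (clockInt ε M Y t) = Y t 2 := by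
    rw [mul_assoc, hinv, mul_one]
  have hu1 := mul_le_mul_of_nonneg_right key hP.le
  have hu2 : (ℓ * exp (-clockInt ε M Y τ) + q / m * E) * exp (clockInt ε M Y t) =
      ℓ * (exp (-clockInt ε M Y τ) * exp (clockInt ε M Y t)) +
        k / m * E * (exp (-clockInt ε M Y t) * exp (clockInt ε M Y t)) := by
    rw [hq]; ring
  rw [e1, hu2, hinv, mul_one] at hu1
  have hu3 : ℓ * (exp (-clockInt ε M Y τ) * exp (clockInt ε M Y t)) ≤ ℓ * E :=
    mul_le_mul_of_nonneg_left hshift hℓ0.le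
  have hu4 : k / m * E ≤ ℓ * E := mul_le_mul_of_nonneg_right hkℓ hE0.le
  have hl1 := mul_le_mul_of_nonneg_right key2 hP.le
  have hl2 : (ℓ * exp (-clockInt ε M Y τ) - p / m * E) * exp (clockInt ε M Y t) =
      ℓ * (exp (-clockInt ε M Y τ) * exp (clockInt ε M Y t)) -
        δ / m * E * (exp (-clockInt ε M Y t) * exp (clockInt ε M Y t)) := by
    rw [hp]; ring
  rw [e1, hl2, hinv, mul_one] at hl1
  have hl3 : 0 ≤ ℓ * (exp (-clockInt ε M Y τ) * exp (clockInt ε M Y t)) := by positivity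
  have hl4 : δ / m * E ≤ ℓ * E := mul_le_mul_of_nonneg_right hδm hE0.le
  have hℓE : 0 ≤ ℓ * E := by positivity
  rw [hEgoal, abs_le]
  constructor <;> linarith

/-! ## §3. The clock keeps running after `τ` -/

/-- **`b ≳ ε` after the trigger level**: `b ≥ (9/10)ε` on `[τ, T']` (`b(τ) ≥ (49/50)ε`,
`ḃ ≥ -ε⁻¹Mc² - δ ≥ -ε/16 - δ` by the a-priori bound and `Mε²e^{5M} ≤ 1/64`, `t - τ ≤ 1`).
[cite: Tao2016AveragedNS, §5.5 "b(t) ≳ ε for t ∈ [t_c, 2]"] -/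
theorem b_ge_after' {t : ℝ} (ht : t ∈ Icc τ T') : 9 / 10 * ε ≤ Y t 1 := by
  obtain ⟨hM6000, hε1, -, -, -, -, -, -, -⟩ := ignition_params hK hML hMK hε hεle
  obtain ⟨hδ₀, hδ, -, -, -, hs1⟩ := budget_facts' hV hT hK hML hMK hε hεle h0 hη
  obtain ⟨hℓ0, hℓε, -, -, -⟩ := level_facts hK hML hMK hε hεle
  obtain ⟨hsε, h3s, hδs, -⟩ := late_facts' hV hT hK hML hMK hε hεle h0 hη
  obtain ⟨hx64, -, -, -⟩ := transition_params hK hML hMK hε hεle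
  have hM0 : 0 < M := by linarith
  have hτ0 : (0 : ℝ) ≤ τ := by linarith
  obtain ⟨ℓ, hℓ⟩ : ∃ ℓ : ℝ, ℓ = ε ^ 2 / K ^ 10 := ⟨_, rfl⟩
  rw [← hℓ] at hℓ0 hℓε h3s
  -- the clock drain `Mc² ≤ ε²/16` on `[τ, T']`
  have hC : ∀ u ∈ Icc τ T', M * Y u 2 ^ 2 ≤ ε ^ 2 / 16 := by
    intro u hu
    have h1 := abs_c_le_after' hY hV hR hT hT'T hT'2 hK hML hMK hε hεle h0 hη hτ1 hcτ hu
    rw [← hℓ] at h1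
    have huτ : u - τ ≤ 1 := by linarith [hu.2]
    have h2a : 201 / 100 * M * (u - τ) ≤ 201 / 100 * M * 1 :=
      mul_le_mul_of_nonneg_left huτ (by positivity)
    have h2 : exp (201 / 100 * M * (u - τ)) ≤ exp (5 / 2 * M) := exp_le_exp.2 (by linarith)
    have h3 : |Y u 2| ≤ 2 * ℓ * exp (5 / 2 * M) :=
      h1.trans (mul_le_mul_of_nonneg_left h2 (by positivity))
    have h4 : Y u 2 ^ 2 ≤ (2 * ℓ * exp (5 / 2 * M)) ^ 2 := by
      rw [← sq_abs]; exact pow_le_pow_left₀ (abs_nonneg _) h3 2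
    have h5 : (2 * ℓ * exp (5 / 2 * M)) ^ 2 = 4 * ℓ ^ 2 * exp (5 * M) := by
      rw [mul_pow, mul_pow, sq (exp _), ← exp_add]; ring_nf
    have hℓ2 : ℓ ^ 2 ≤ (ε ^ 2) ^ 2 := pow_le_pow_left₀ hℓ0.le hℓε 2
    have h6 : M * Y u 2 ^ 2 ≤ M * (4 * (ε ^ 2) ^ 2 * exp (5 * M)) := by
      refine mul_le_mul_of_nonneg_left (h4.trans ?_) hM0.le
      rw [h5]
      exact mul_le_mul_of_nonneg_right (mul_le_mul_of_nonneg_left hℓ2 (by norm_num)) (exp_pos _).le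
    have h7 : M * (4 * (ε ^ 2) ^ 2 * exp (5 * M)) = 4 * ε ^ 2 * (M * ε ^ 2 * exp (5 * M)) := by
      ring
    have h8 : 4 * ε ^ 2 * (M * ε ^ 2 * exp (5 * M)) ≤ 4 * ε ^ 2 * (1 / 64) :=
      mul_le_mul_of_nonneg_left hx64 (by positivity)
    linarith
  obtain ⟨r, hr⟩ : ∃ r : ℝ, r = ε / 16 + δ := ⟨_, rfl⟩
  have hr0 : 0 ≤ r := by rw [hr]; positivity
  have hmono := Thm53.monotoneOn_sub_of_le_deriv (s := Icc τ T') (f := fun s => Y s 1)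
    (φ := fun _ => -r) (Φ := fun u => -r * u) (convex_Icc τ T')
    (fun u _ => hasDerivAt_coord (hY u) 1)
    (fun u _ => by simpa using (hasDerivAt_id u).const_mul (-r))
    (fun u hu => by
      have hu' : u ∈ Icc (0 : ℝ) T' := ⟨hτ0.trans hu.1, hu.2⟩
      have hθ := (abs_le.1 (abs_coord_defect_le (hV u (mem_Ico_of_mem_late hT'T hu')) 1)).1
      rw [field_one] at hθ
      have h1 : 0 ≤ ε * Y u 0 ^ 2 := by positivity
      have h2 : ε⁻¹ * M * Y u 2 ^ 2 ≤ ε / 16 := by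
        rw [show ε⁻¹ * M * Y u 2 ^ 2 = M * Y u 2 ^ 2 / ε by ring, div_le_iff₀ hε]
        have e : ε / 16 * ε = ε ^ 2 / 16 := by ring
        linarith [hC u hu]
      show -r ≤ V u 1
      rw [hr]; linarith)
  have h := hmono (left_mem_Icc.2 (ht.1.trans ht.2)) ht ht.1
  simp only at h
  have htτ : t - τ ≤ 1 := by linarith [ht.2]
  have h2 : r * (t - τ) ≤ r * 1 := mul_le_mul_of_nonneg_left htτ hr0
  have hδε : δ ≤ ε / 100 := by
    have : ε ^ 2 * exp (-M) / 16 ≤ ε / 1000000 / 16 := by linarith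
    linarith
  linarith

/-! ## §4. Exponential growth of the trigger and (c-large) -/

/-- **Growth after the trigger level.** On `[τ, T']`: `c(t) ≥ ½(ε²/K¹⁰)·e^{(9/10)M(t-τ)}`
(the clock integral grows at rate `ε⁻¹Mb ≥ (9/10)M`, the discounted trigger loses at most
`δ(t-τ)e^{-G(τ)} ≤ ½ℓe^{-G(τ)}`). [cite: Tao2016AveragedNS, §5.5 (c-large)] -/
theorem c_ge_after' {t : ℝ} (ht : t ∈ Icc τ T') :
    ε ^ 2 / K ^ 10 / 2 * exp (9 / 10 * M * (t - τ)) ≤ Y t 2 := by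
  obtain ⟨hM6000, hε1, -, -, -, -, -, -, -⟩ := ignition_params hK hML hMK hε hεle
  obtain ⟨hδ₀, hδ, -, -, -, hs1⟩ := budget_facts' hV hT hK hML hMK hε hεle h0 hη
  obtain ⟨hℓ0, hℓε, -, -, -⟩ := level_facts hK hML hMK hε hεle
  obtain ⟨hsε, h3s, hδs, -⟩ := late_facts' hV hT hK hML hMK hε hεle h0 hη
  have hM0 : 0 < M := by linarith
  have hτ0 : (0 : ℝ) ≤ τ := by linarith
  have hτt : τ ≤ t := ht.1
  have hbge : ∀ u ∈ Icc τ T', 9 / 10 * ε ≤ Y u 1 := fun u hu =>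
    b_ge_after' hY hV hR hT hT'T hT'2 hK hML hMK hε hεle h0 hη hτ1 hcτ hbτ hu
  obtain ⟨ℓ, hℓ⟩ : ∃ ℓ : ℝ, ℓ = ε ^ 2 / K ^ 10 := ⟨_, rfl⟩
  rw [← hℓ] at hℓ0 hℓε h3s hcτ ⊢
  -- the clock integral grows at rate ≥ (9/10)M on [τ, T']
  obtain ⟨n, hn⟩ : ∃ n : ℝ, n = 9 / 10 * M := ⟨_, rfl⟩
  have hn0 : 0 ≤ n := by rw [hn]; positivity
  have hGmono := Thm53.monotoneOn_sub_of_le_deriv (s := Icc τ T') (f := clockInt ε M Y)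
    (φ := fun _ => n) (Φ := fun u => n * u) (convex_Icc τ T')
    (fun u _ => hasDerivAt_clockIntA hY u)
    (fun u _ => by simpa using (hasDerivAt_id u).const_mul n)
    (fun u hu => by
      have h1 : ε⁻¹ * M * (9 / 10 * ε) ≤ ε⁻¹ * M * Y u 1 :=
        mul_le_mul_of_nonneg_left (hbge u hu) (by positivity)
      have e : ε⁻¹ * M * (9 / 10 * ε) = n := by
        rw [show ε⁻¹ * M * (9 / 10 * ε) = 9 / 10 * M * (ε⁻¹ * ε) by ring,
          inv_mul_cancel₀ hε.ne', mul_one, hn]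
      show n ≤ ε⁻¹ * M * Y u 1
      linarith)
  have hGτ : ∀ u ∈ Icc τ t, clockInt ε M Y τ ≤ clockInt ε M Y u := by
    intro u hu
    have h := hGmono (left_mem_Icc.2 (ht.1.trans ht.2)) ⟨hu.1, hu.2.trans ht.2⟩ hu.1
    simp only at h
    have : n * τ ≤ n * u := mul_le_mul_of_nonneg_left hu.1 hn0
    linarith
  have hGt : n * (t - τ) ≤ clockInt ε M Y t - clockInt ε M Y τ := by
    have h := hGmono (left_mem_Icc.2 (ht.1.trans ht.2)) ht ht.1
    simp only at h
    linarith
  -- the discounted trigger loses at most `p = δe^{-G(τ)}` per unit time on [τ, t]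
  obtain ⟨p, hp⟩ : ∃ p : ℝ, p = δ * exp (-clockInt ε M Y τ) := ⟨_, rfl⟩
  have hp0 : 0 ≤ p := by rw [hp]; positivity
  have hmono := Thm53.monotoneOn_sub_of_le_deriv (s := Icc τ t)
    (f := fun s => Y s 2 * exp (-clockInt ε M Y s)) (φ := fun _ => -p) (Φ := fun u => -p * u)
    (convex_Icc τ t) (fun u _ => hasDerivAt_discA hY u)
    (fun u _ => by simpa using (hasDerivAt_id u).const_mul (-p))
    (fun u hu => by
      have hu' : u ∈ Icc (0 : ℝ) T' := ⟨hτ0.trans hu.1, hu.2.trans ht.2⟩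
      have h1 := disc_deriv_ge_late hV hT'T hu' (K := K)
      have h2 : 0 ≤ ε ^ 2 * exp (-M) * Y u 0 ^ 2 * exp (-clockInt ε M Y u) := by positivity
      have h3 : exp (-clockInt ε M Y u) ≤ exp (-clockInt ε M Y τ) :=
        exp_le_exp.2 (by linarith [hGτ u hu])
      have h4 : δ * exp (-clockInt ε M Y u) ≤ p := by
        rw [hp]; exact mul_le_mul_of_nonneg_left h3 hδ
      show -p ≤ (V u 2 - ε⁻¹ * M * Y u 1 * Y u 2) * exp (-clockInt ε M Y u)
      linarith [h1, h2, h4])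
  have h := hmono (left_mem_Icc.2 hτt) (right_mem_Icc.2 hτt) hτt
  simp only at h
  rw [hcτ] at h
  have htτ : t - τ ≤ 1 := by linarith [ht.2]
  have hpt : p * (t - τ) ≤ p * 1 := mul_le_mul_of_nonneg_left htτ hp0
  have hδℓ : δ ≤ ℓ / 2 := by linarith
  have h5 : δ * exp (-clockInt ε M Y τ) ≤ ℓ / 2 * exp (-clockInt ε M Y τ) :=
    mul_le_mul_of_nonneg_right hδℓ (exp_pos _).le
  rw [← hp] at h5
  have key : ℓ / 2 * exp (-clockInt ε M Y τ) ≤ Y t 2 * exp (-clockInt ε M Y t) := by linarith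
  -- undo the discount
  have hP : 0 < exp (clockInt ε M Y t) := exp_pos _
  have h6 := mul_le_mul_of_nonneg_right key hP.le
  have e1 : Y t 2 * exp (-clockInt ε M Y t) * exp (clockInt ε M Y t) = Y t 2 := by
    rw [mul_assoc, ← exp_add, neg_add_cancel, exp_zero, mul_one]
  have e2 : ℓ / 2 * exp (-clockInt ε M Y τ) * exp (clockInt ε M Y t) =
      ℓ / 2 * exp (clockInt ε M Y t - clockInt ε M Y τ) := by
    rw [mul_assoc, ← exp_add,
      show -clockInt ε M Y τ + clockInt ε M Y t = clockInt ε M Y t - clockInt ε M Y τ by ring]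
  rw [e1, e2] at h6
  have h7 : exp (9 / 10 * M * (t - τ)) ≤ exp (clockInt ε M Y t - clockInt ε M Y τ) := by
    rw [← hn]; exact exp_le_exp.2 hGt
  calc ℓ / 2 * exp (9 / 10 * M * (t - τ))
      ≤ ℓ / 2 * exp (clockInt ε M Y t - clockInt ε M Y τ) :=
        mul_le_mul_of_nonneg_left h7 (by positivity)
    _ ≤ Y t 2 := h6

/-- **(c-large) for approximate trajectories.** For any onset delay `d ≥ 0` with
`e^{(9/10)Md} ≥ 2K¹¹⁰`: `c ≥ K¹⁰⁰ε²` on `[τ + d, T']` — "the rotor gate will be continuously and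
strongly activated from time `t_c + d` onwards". [cite: Tao2016AveragedNS, §5.5 (c-large)] -/
theorem c_large_after' {d : ℝ} (hd : 0 ≤ d) (hon : 2 * K ^ 110 ≤ exp (9 / 10 * M * d)) {t : ℝ}
    (ht : t ∈ Icc (τ + d) T') : K ^ 100 * ε ^ 2 ≤ Y t 2 := by
  obtain ⟨hM6000, -, -, -, -, -, -, -, -⟩ := ignition_params hK hML hMK hε hεle
  obtain ⟨hK16, -, -, -, -, -⟩ := negKick_params hK hML hMK hε hεle
  have hK0 : 0 < K := by linarith
  have hM0 : 0 < M := by linarith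
  have ht' : t ∈ Icc τ T' := ⟨by linarith [ht.1], ht.2⟩
  have hg := c_ge_after' hY hV hR hT hT'T hT'2 hK hML hMK hε hεle h0 hη hτ1 hcτ hbτ ht'
  have hexp : exp (9 / 10 * M * d) ≤ exp (9 / 10 * M * (t - τ)) :=
    exp_le_exp.2 (mul_le_mul_of_nonneg_left (by linarith [ht.1]) (by positivity))
  have e : K ^ 100 * ε ^ 2 = ε ^ 2 / K ^ 10 / 2 * (2 * K ^ 110) := by
    rw [div_div, div_mul_eq_mul_div, eq_div_iff (by positivity)]; ring
  calc K ^ 100 * ε ^ 2 = ε ^ 2 / K ^ 10 / 2 * (2 * K ^ 110) := e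
    _ ≤ ε ^ 2 / K ^ 10 / 2 * exp (9 / 10 * M * d) := mul_le_mul_of_nonneg_left hon (by positivity)
    _ ≤ ε ^ 2 / K ^ 10 / 2 * exp (9 / 10 * M * (t - τ)) :=
        mul_le_mul_of_nonneg_left hexp (by positivity)
    _ ≤ Y t 2 := hg

end Entry

end Eighth

section Seed

variable (hK : 2 * 20 ^ 42 * (Nat.factorial 42 : ℝ) + 16 ≤ K) (hML : 3000 * Real.log K ≤ M)
  (hMK : M ≤ K ^ 10) (hε : 0 < ε) (hεle : ε ≤ exp (-(10 * M)) / K ^ 100)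
  (h0 : ‖Y 0 - delayInit‖ ≤ δ₀) (hη : δ₀ + 2 * δ ≤ ε ^ 2 * exp (-M) / (8 * Real.sqrt M))
include hK hML hMK hε hεle h0 hη

omit hY hR hT'T hT'2 in
/-- Budget arithmetic of the transition phase: `ε²e^{-M} ≤ ε/10⁶`, `3ε²e^{-M} ≤ ε²/K¹⁰`,
`δ ≤ ε²e^{-M}/16`, `7δ₀ + 40δ ≤ (5/2)ε²e^{-M}`. [cite: Tao2016AveragedNS, §5.5] -/
theorem late_facts :
    ε ^ 2 * exp (-M) ≤ ε / 1000000 ∧ 3 * (ε ^ 2 * exp (-M)) ≤ ε ^ 2 / K ^ 10 ∧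
      δ ≤ ε ^ 2 * exp (-M) / 16 ∧ 7 * δ₀ + 40 * δ ≤ 5 / 2 * (ε ^ 2 * exp (-M)) :=
  late_facts' hV hT hK hML hMK hε hεle h0 (budget_le_eighth hK hML hMK hε hεle hη)

/-- **The clock on the late window**: `b ≤ (201/100)ε` on `[0, T']`. [cite: Tao2016AveragedNS, §5.5 (5.5)] -/
theorem b_le_two_late {t : ℝ} (ht : t ∈ Icc (0 : ℝ) T') : Y t 1 ≤ 201 / 100 * ε :=
  b_le_two_late' hY hV hR hT hT'T hT'2 hK hML hMK hε hεle h0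
    (budget_le_eighth hK hML hMK hε hεle hη) ht

/-- **Clock increments on the late window**: `G(t) - G(u) ≤ (201/100)M(t - u)` for
`0 ≤ u ≤ t ≤ T'` (`G' = ε⁻¹Mb ≤ (201/100)M`). [cite: Tao2016AveragedNS, §5.5] -/
theorem clockInt_sub_le_late {u t : ℝ} (hu : 0 ≤ u) (hut : u ≤ t) (ht : t ≤ T') :
    clockInt ε M Y t - clockInt ε M Y u ≤ 201 / 100 * M * (t - u) :=
  clockInt_sub_le_late' hY hV hR hT hT'T hT'2 hK hML hMK hε hεle h0
    (budget_le_eighth hK hML hMK hε hεle hη) hu hut ht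

section Entry

variable {τ : ℝ} (hτ1 : 1 < τ) (hcτ : Y τ 2 = ε ^ 2 / K ^ 10) (hbτ : 49 / 50 * ε ≤ Y τ 1)
include hτ1 hcτ hbτ

/-! ## §2. The a-priori size of the trigger after `τ` -/

omit hbτ in
/-- **A-priori bound after the trigger level.** On `[τ, T']`:
`|c(t)| ≤ 2(ε²/K¹⁰)·e^{(201/100)M(t-τ)}`. Both signs come from the discounted trigger
`D = c·e^{-G}`: `|D'| ≤ (ε²e^{-M}·(1+7δ₀+40δ) + δ)·e^{-G(u)}` and
`e^{-G(u)} ≤ e^{-G(t)}·e^{(201/100)M(t-u)}` (clock increments), integrated in closed form.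
[cite: Tao2016AveragedNS, §5.5 (code)] -/
theorem abs_c_le_after {t : ℝ} (ht : t ∈ Icc τ T') :
    |Y t 2| ≤ 2 * (ε ^ 2 / K ^ 10) * exp (201 / 100 * M * (t - τ)) :=
  abs_c_le_after' hY hV hR hT hT'T hT'2 hK hML hMK hε hεle h0
    (budget_le_eighth hK hML hMK hε hεle hη) hτ1 hcτ ht

/-! ## §3. The clock keeps running after `τ` -/

/-- **`b ≳ ε` after the trigger level**: `b ≥ (9/10)ε` on `[τ, T']` (`b(τ) ≥ (49/50)ε`,
`ḃ ≥ -ε⁻¹Mc² - δ ≥ -ε/16 - δ` by the a-priori bound and `Mε²e^{5M} ≤ 1/64`, `t - τ ≤ 1`).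
[cite: Tao2016AveragedNS, §5.5 "b(t) ≳ ε for t ∈ [t_c, 2]"] -/
theorem b_ge_after {t : ℝ} (ht : t ∈ Icc τ T') : 9 / 10 * ε ≤ Y t 1 :=
  b_ge_after' hY hV hR hT hT'T hT'2 hK hML hMK hε hεle h0
    (budget_le_eighth hK hML hMK hε hεle hη) hτ1 hcτ hbτ ht

/-! ## §4. Exponential growth of the trigger and (c-large) -/

/-- **Growth after the trigger level.** On `[τ, T']`: `c(t) ≥ ½(ε²/K¹⁰)·e^{(9/10)M(t-τ)}`
(the clock integral grows at rate `ε⁻¹Mb ≥ (9/10)M`, the discounted trigger loses at most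
`δ(t-τ)e^{-G(τ)} ≤ ½ℓe^{-G(τ)}`). [cite: Tao2016AveragedNS, §5.5 (c-large)] -/
theorem c_ge_after {t : ℝ} (ht : t ∈ Icc τ T') :
    ε ^ 2 / K ^ 10 / 2 * exp (9 / 10 * M * (t - τ)) ≤ Y t 2 :=
  c_ge_after' hY hV hR hT hT'T hT'2 hK hML hMK hε hεle h0
    (budget_le_eighth hK hML hMK hε hεle hη) hτ1 hcτ hbτ ht

/-- **(c-large) for approximate trajectories.** For any onset delay `d ≥ 0` with
`e^{(9/10)Md} ≥ 2K¹¹⁰`: `c ≥ K¹⁰⁰ε²` on `[τ + d, T']` — "the rotor gate will be continuously and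
strongly activated from time `t_c + d` onwards". [cite: Tao2016AveragedNS, §5.5 (c-large)] -/
theorem c_large_after {d : ℝ} (hd : 0 ≤ d) (hon : 2 * K ^ 110 ≤ exp (9 / 10 * M * d)) {t : ℝ}
    (ht : t ∈ Icc (τ + d) T') : K ^ 100 * ε ^ 2 ≤ Y t 2 :=
  c_large_after' hY hV hR hT hT'T hT'2 hK hML hMK hε hεle h0
    (budget_le_eighth hK hML hMK hε hεle hη) hτ1 hcτ hbτ hd hon ht

end Entry

end Seed

end Late

end Approx

end Ignition

/-! ## §5. Exported statement -/

/-- **The rotor gate of an approximate trajectory is strongly activated (explicit hypotheses).**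
For every member `delayCircuitWith K M ε` under the standing hypotheses of the family and every
differentiable approximate trajectory `Y` (velocity `V`, sup-defect `≤ δ` and sup-norm `≤ 2` on
`[0,T)`, `T ≥ 2`) issued `δ₀`-close to Tao's datum (5.6) with `δ₀ + δT ≤ ε²e^{-M}/(8√M)`, there is
a trigger time `τ ∈ (1, 8/5]` (`c(τ) = ε²/K¹⁰`, `|c| < ε²/K¹⁰` before) such that on every late
window `[τ, T']`, `T' < T`, `T' ≤ 2`: the clock satisfies `(9/10)ε ≤ b ≤ (201/100)ε`, the trigger
`½(ε²/K¹⁰)e^{(9/10)M(t-τ)} ≤ c ≤ 2(ε²/K¹⁰)e^{(201/100)M(t-τ)}` (in absolute value on the right), and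
`c ≥ K¹⁰⁰ε²` from `τ + 130 log K/M` on [Tao2016AveragedNS, §5.5 (c-large)] — for pseudo-orbits at
the seed-scale budget. [cite: Tao2016AveragedNS, §5.5 Theorem 5.3] -/
theorem rotorGate_activated (K M ε δ δ₀ T : ℝ) (Y V : ℝ → Fin 5 → ℝ)
    (hK : 2 * 20 ^ 42 * (Nat.factorial 42 : ℝ) + 16 ≤ K) (hML : 3000 * Real.log K ≤ M)
    (hMK : M ≤ K ^ 10) (hε : 0 < ε) (hεle : ε ≤ exp (-(10 * M)) / K ^ 100) (hT : 2 ≤ T)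
    (hY : ∀ t, HasDerivAt Y (V t) t)
    (hV : ∀ t ∈ Ico 0 T, ‖V t - delayCircuitWith K M ε (Y t)‖ ≤ δ)
    (hR : ∀ t ∈ Ico 0 T, ‖Y t‖ ≤ 2) (h0 : ‖Y 0 - delayInit‖ ≤ δ₀)
    (hB : δ₀ + δ * T ≤ ε ^ 2 * exp (-M) / (8 * Real.sqrt M)) :
    ∃ τ ∈ Ioc (1 : ℝ) (8 / 5), Y τ 2 = ε ^ 2 / K ^ 10 ∧
      (∀ t ∈ Ico (0 : ℝ) τ, |Y t 2| < ε ^ 2 / K ^ 10) ∧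
      ∀ T', T' < T → T' ≤ 2 →
        (∀ t ∈ Icc τ T', 9 / 10 * ε ≤ Y t 1 ∧ Y t 1 ≤ 201 / 100 * ε ∧
          ε ^ 2 / K ^ 10 / 2 * exp (9 / 10 * M * (t - τ)) ≤ Y t 2 ∧
          |Y t 2| ≤ 2 * (ε ^ 2 / K ^ 10) * exp (201 / 100 * M * (t - τ))) ∧
        ∀ t ∈ Icc (τ + 130 * Real.log K / M) T', K ^ 100 * ε ^ 2 ≤ Y t 2 := by
  have hδ : 0 ≤ δ := Ignition.defect_nonneg hV hT
  have hη : δ₀ + 2 * δ ≤ ε ^ 2 * exp (-M) / (8 * Real.sqrt M) := by nlinarith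
  obtain ⟨τ, hτ, hcτ, hbefore, -, hblate, -⟩ :=
    Ignition.exists_triggerLevel_hit hY hV hR hT hK hML hMK hε hεle h0 hη
  have hbτ : 49 / 50 * ε ≤ Y τ 1 := hblate τ ⟨hτ.1.le, le_rfl⟩
  obtain ⟨-, hon, hd0, -⟩ := Ignition.transition_params hK hML hMK hε hεle
  refine ⟨τ, hτ, hcτ, hbefore, fun T' hT'T hT'2 => ⟨fun t ht => ⟨?_, ?_, ?_, ?_⟩, fun t ht => ?_⟩⟩
  · exact Ignition.b_ge_after hY hV hR hT hT'T hT'2 hK hML hMK hε hεle h0 hη hτ.1 hcτ hbτ ht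
  · exact Ignition.b_le_two_late hY hV hR hT hT'T hT'2 hK hML hMK hε hεle h0 hη
      ⟨by linarith [hτ.1, ht.1], ht.2⟩
  · exact Ignition.c_ge_after hY hV hR hT hT'T hT'2 hK hML hMK hε hεle h0 hη hτ.1 hcτ hbτ ht
  · exact Ignition.abs_c_le_after hY hV hR hT hT'T hT'2 hK hML hMK hε hεle h0 hη hτ.1 hcτ ht
  · exact Ignition.c_large_after hY hV hR hT hT'T hT'2 hK hML hMK hε hεle h0 hη hτ.1 hcτ hbτ
      hd0 hon ht

end Literature.Analysis.FluidPDE.Tao2016AveragedNS
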